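import Summits.FinalStateConjecture.FinalStateConjecture.Theorems.LaminatedThresholdAssemblyFrame
import Summits.FinalStateConjecture.FinalStateConjecture.Theorems.LaminatedThresholdTameExitsLocaliseTailGluing

/-!
# Route `LaminatedThreshold` · the k2 RE-CUT deciding theorem, kernel-checked in `Theorems/`:
# naked-saturated laminated threshold `A⁺` + tail gluing S1 ⇒ `¬ FinalStateConjecture` (crux B bypassed)

Helper file of prover seat 1 (route-affinity) — `--supports stmt-FinalStateConjecture-16894`.

The tenure planner's candidate re-cut of the route (crux dir `Cruxes/TameExitsLocalise/IdeatorK2Sketch.lean`,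
`closes_recut`, ideator k2, 2026-08-17) replaces crux B `TameExitsLocalise` (whose hyperbolic stubs S2/S3 are
research-open) by: crux A strengthened to NAKED saturation `A⁺` (an abstract local badness certificate `Nk`
which implies exceptionality (NL), transfers between admissible data agreeing on a compact core set `S` (NT),
and holds at every `K`-coded member of every compactly supported admissible family through `d⋆`; plus: no
Killing tail on the sole end) and birth's ELLIPTIC stub S1 `ParametricTailGluing` alone. This file lands that
deciding theorem over importable vocabulary (the sketch imports the crux skeleton, which `Theorems/` cannot):

* `not_finalStateConjecture_of_nakedLamination` (registered support stub) — `S1 (verbatim, NoKillingTail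
  unfolded) → A⁺ (verbatim, Good := the summit's property, NoKillingTail unfolded) → ¬ FinalStateConjecture`.
  Proof = the sketch's: from FSC take the tame exit `F` at `d⋆`; glue it to `d⋆`'s own tail beyond a radius
  past `S` (S1); along the ray `t ↦ L (t e₀)` of the glued LOCAL family the lamination lemma
  (`real_lamination`, `LaminatedThresholdAssemblyFrame.lean`) produces a `K`-coded member at some
  `0 < t < min δ ε₁`; it is `Nk` (saturation), so is the exit member `F (t e₀)` with the same core (NT), so that
  member is exceptional (NL) — but it is good (`t e₀ ≠ 0`). No goodness of glued data, no stability, no S2/S3.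
* `not_finalStateConjecture_of_nakedLamination_of_gluing` — the same with S1 discharged by
  `parametricTailGluing_of_annulusGluing` (`LaminatedThresholdTameExitsLocaliseTailGluing.lean`), i.e.
  **`ChruscielDelay_parametricAnnulusGluing → A⁺ → ¬ FinalStateConjecture`**: under the re-cut the whole route
  hinges on ONE research statement (`A⁺`) and ONE named Literature fact.

Nothing here bears on the truth of `A⁺` (open: an exhibited admissible datum with a naked, saturating threshold).
-/

noncomputable section

-- `Summit.FinalStateConjecture.FinalStateConjecture.…` is the mandated Theorems namespace (summit = problem name).
set_option linter.dupNamespace false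

open Set Filter Function
open scoped Manifold ContDiff Topology
open Literature.Geometry.Lorentzian
open Summit.FinalStateConjecture.FinalStateConjecture.Theorems.ClusterCompleteness (SettlesT2)

namespace Summit.FinalStateConjecture.FinalStateConjecture.Theorems.LaminatedThreshold.TailGluing

/-- **Re-cut deciding theorem: tail gluing S1 + naked-saturated laminated threshold A⁺ refute the re-typed
`FinalStateConjecture`** (registered support stub; the crux-dir sketch `IdeatorK2Sketch.closes_recut` over
importable vocabulary, proof via `real_lamination`). Hypothesis 1 is `Birth.ParametricTailGluing` verbatim
(`NoKillingTail` unfolded); hypothesis 2 is `IdeatorK2.LaminatedThresholdNaked` verbatim (`Good` = the summit's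
property with `SettlesT2`, `NoKillingTail` unfolded). -/
theorem not_finalStateConjecture_of_nakedLamination : (∀ (X : Type) [TopologicalSpace X] [ChartedSpace E3 X] [IsManifold (𝓡 3) ∞ X] [T2Space X] [SecondCountableTopology X] [ConnectedSpace X] (e : AFEnd X) (dstar : InitialDataSet (𝓡 3) X) (F : EuclideanSpace ℝ (Fin 1) → InitialDataSet (𝓡 3) X), dstar ∈ admissibleVacuumData X → InitialDataSet.IsTameDataFamily e 1 F → InitialDataSet.IsImmersedAtZero 1 F → F 0 = dstar → Function.Injective F → (∀ c, F c ∈ admissibleVacuumData X) → (∀ R₀ : ℝ, ∃ R₁ R₂ : ℝ, R₀ ≤ R₁ ∧ e.R ≤ R₁ ∧ R₁ < R₂ ∧ ¬ ∃ (N : E3 → ℝ) (Y : E3 → E3), ContDiffOn ℝ ∞ N {y : E3 | R₁ < ‖y‖ ∧ ‖y‖ < R₂} ∧ ContDiffOn ℝ ∞ Y {y : E3 | R₁ < ‖y‖ ∧ ‖y‖ < R₂} ∧ (∃ y : E3, R₁ < ‖y‖ ∧ ‖y‖ < R₂ ∧ (N y ≠ 0 ∨ Y y ≠ 0)) ∧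 ∀ y : E3, R₁ < ‖y‖ → ‖y‖ < R₂ → MetricCoord.adjHamG (e.hCoeff dstar) (e.kCoeff dstar) N y + MetricCoord.adjMomGS (e.hCoeff dstar) (e.kCoeff dstar) Y y = 0 ∧ MetricCoord.adjHamK (e.hCoeff dstar) (e.kCoeff dstar) N y + MetricCoord.adjMomKS (e.hCoeff dstar) Y y = 0) → ∀ R₀ : ℝ, ∃ R₁ : ℝ, R₀ ≤ R₁ ∧ ∃ (F' : EuclideanSpace ℝ (Fin 1) → InitialDataSet (𝓡 3) X) (ε₁ : ℝ), InitialDataSet.IsSmoothDataFamily 1 F' ∧ InitialDataSet.IsImmersedAtZero 1 F' ∧ F' 0 = dstar ∧ Function.Injective F' ∧ (∀ c, F' c ∈ admissibleVacuumData X) ∧ (∃ C : Set X, IsCompact C ∧ ∀ c, ∀ x ∉ C, (F' c).h.inner x = dstar.h.inner x ∧ (F' c).k x = dstar.k x) ∧ 0 < ε₁ ∧ ∀ c, ‖c‖ < ε₁ → ∀ x ∉ e.far R₁, (F' c).h.inner x = (F c).h.inner x ∧ (F' c).k x = (F c).k x) → (∃ (X : Type) (_ : TopologicalSpace X) (_ :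 ChartedSpace E3 X) (_ : IsManifold (𝓡 3) ∞ X) (_ : T2Space X) (_ : SecondCountableTopology X) (_ : ConnectedSpace X) (dstar : InitialDataSet (𝓡 3) X) (Φ : InitialDataSet (𝓡 3) X → ℝ) (K : Set ℝ) (S : Set X) (Nk : InitialDataSet (𝓡 3) X → Prop), dstar ∈ admissibleVacuumData X ∧ ¬ ((∃ 𝒟 : VacuumCauchyDevelopment dstar, 𝒟.IsMaximal) ∧ ∀ 𝒟 : VacuumCauchyDevelopment dstar, 𝒟.IsMaximal → SettlesT2 𝒟) ∧ IsCompact S ∧ (∀ e : AFEnd X, e.IsSoleEnd → ∀ R₀ : ℝ, ∃ R₁ R₂ : ℝ, R₀ ≤ R₁ ∧ e.R ≤ R₁ ∧ R₁ < R₂ ∧ ¬ ∃ (N : E3 → ℝ) (Y : E3 → E3), ContDiffOn ℝ ∞ N {y : E3 | R₁ < ‖y‖ ∧ ‖y‖ < R₂} ∧ ContDiffOn ℝ ∞ Y {y : E3 | R₁ < ‖y‖ ∧ ‖y‖ < R₂} ∧ (∃ y : E3, R₁ < ‖y‖ ∧ ‖y‖ < R₂ ∧ (N y ≠ 0 ∨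 Y y ≠ 0)) ∧ ∀ y : E3, R₁ < ‖y‖ → ‖y‖ < R₂ → MetricCoord.adjHamG (e.hCoeff dstar) (e.kCoeff dstar) N y + MetricCoord.adjMomGS (e.hCoeff dstar) (e.kCoeff dstar) Y y = 0 ∧ MetricCoord.adjHamK (e.hCoeff dstar) (e.kCoeff dstar) N y + MetricCoord.adjMomKS (e.hCoeff dstar) Y y = 0) ∧ (∀ d ∈ admissibleVacuumData X, Nk d → ¬ ((∃ 𝒟 : VacuumCauchyDevelopment d, 𝒟.IsMaximal) ∧ ∀ 𝒟 : VacuumCauchyDevelopment d, 𝒟.IsMaximal → SettlesT2 𝒟)) ∧ (∀ d₁ ∈ admissibleVacuumData X, ∀ d₂ ∈ admissibleVacuumData X, (∀ x ∈ S, d₁.h.inner x = d₂.h.inner x ∧ d₁.k x = d₂.k x) → Nk d₁ → Nk d₂) ∧ Φ dstar ∈ K ∧ (∀ ε : ℝ, 0 < ε → (K ∩ Set.Ioo (Φ dstar - ε) (Φ dstar)).Nonempty ∧ (K ∩ Set.Ioo (Φ dstar) (Φ dstar + ε)).Nonempty) ∧ ∀ F : EuclideanSpace ℝ (Fin 1)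 → InitialDataSet (𝓡 3) X, InitialDataSet.IsSmoothDataFamily 1 F → F 0 = dstar → (∀ c, F c ∈ admissibleVacuumData X) → (∃ C : Set X, IsCompact C ∧ ∀ c, ∀ x ∉ C, (F c).h.inner x = dstar.h.inner x ∧ (F c).k x = dstar.k x) → ∃ δ : ℝ, 0 < δ ∧ ContinuousOn (fun c ↦ Φ (F c)) (Metric.ball 0 δ) ∧ ∀ c ∈ Metric.ball (0 : EuclideanSpace ℝ (Fin 1)) δ, Φ (F c) ∈ K → Nk (F c)) → ¬ FinalStateConjecture := by
  intro hS1 hA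
  obtain ⟨X, i₁, i₂, i₃, i₄, i₅, i₆, dstar, Φ, K, S, Nk, hD, hbad, hS, hnokid, hNL, hNT, hk, hacc, hsat⟩ := hA
  intro hFSC
  obtain ⟨e, F, hF, himm, h0, hinj, hadm, hexc⟩ := hFSC X dstar ⟨hD, hbad⟩
  have hgoodF : ∀ c, c ≠ 0 → (∃ 𝒟 : VacuumCauchyDevelopment (F c), 𝒟.IsMaximal) ∧
      ∀ 𝒟 : VacuumCauchyDevelopment (F c), 𝒟.IsMaximal → SettlesT2 𝒟 := fun c hc ↦ by
    by_contra hP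
    exact hexc c hc ⟨hadm c, hP⟩
  -- glue beyond a radius past the core set `S`
  obtain ⟨R₀, hR₀⟩ := e.exists_forall_far_disjoint hS
  obtain ⟨R₁, hR₀₁, L, ε₁, hL, -, hL0, -, hadmL, hCL, hε₁, hcore⟩ :=
    hS1 X e dstar F hD hF himm h0 hinj hadm (hnokid e hF.2.1) R₀
  have hagree : ∀ c, ‖c‖ < ε₁ → ∀ x ∈ S,
      (L c).h.inner x = (F c).h.inner x ∧ (L c).k x = (F c).k x := fun c hc x hx ↦
    hcore c hc x (Set.disjoint_right.1 (hR₀ R₁ hR₀₁) hx)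
  obtain ⟨δ, hδ, hcont, hK⟩ := hsat L hL hL0 hadmL hCL
  -- the ray `t ↦ L (t e₀)` and the lamination lemma on `[0, min δ ε₁)`
  set v : EuclideanSpace ℝ (Fin 1) := EuclideanSpace.single (0 : Fin 1) (1 : ℝ) with hv
  have hnv : ‖v‖ = 1 := by simp [hv]
  have hv0 : v ≠ 0 := by
    intro h; rw [h, norm_zero] at hnv; exact zero_ne_one hnv
  have hnorm : ∀ t : ℝ, ‖t • v‖ = |t| := fun t ↦ by
    rw [norm_smul, hnv, mul_one, Real.norm_eq_abs]
  have hρ : 0 < min δ ε₁ := lt_min hδ hε₁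
  have hγ : Continuous fun t : ℝ ↦ t • v := continuous_id.smul continuous_const
  have hmaps : Set.MapsTo (fun t : ℝ ↦ t • v) (Set.Ico 0 (min δ ε₁)) (Metric.ball 0 δ) := by
    intro t ht
    rw [mem_ball_zero_iff, hnorm, abs_of_nonneg ht.1]
    exact lt_of_lt_of_le ht.2 (min_le_left _ _)
  have hfcont : ContinuousOn (fun t : ℝ ↦ Φ (L (t • v))) (Set.Ico 0 (min δ ε₁)) :=
    hcont.comp hγ.continuousOn hmaps
  have hf0 : Φ (L ((0 : ℝ) • v)) = Φ dstar := by rw [zero_smul, hL0]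
  obtain ⟨t, ht, htK⟩ := real_lamination (f := fun t : ℝ ↦ Φ (L (t • v))) hρ
    (by simp only [hf0]; exact hk) (by simp only [hf0]; exact hacc) hfcont
  -- badness transfer along the coded member: saturation → NT → NL, against goodness of the exit member
  have htδ : t • v ∈ Metric.ball (0 : EuclideanSpace ℝ (Fin 1)) δ := by
    rw [mem_ball_zero_iff, hnorm, abs_of_pos ht.1]
    exact lt_of_lt_of_le ht.2 (min_le_left _ _)
  have htε : ‖t • v‖ < ε₁ := by
    rw [hnorm, abs_of_pos ht.1]
    exact lt_of_lt_of_le ht.2 (min_le_right _ _)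
  have h₁ : Nk (L (t • v)) := hK (t • v) htδ htK
  have h₂ : Nk (F (t • v)) := hNT (L (t • v)) (hadmL _) (F (t • v)) (hadm _) (hagree (t • v) htε) h₁
  exact hNL (F (t • v)) (hadm _) h₂ (hgoodF (t • v) (smul_ne_zero (ne_of_gt ht.1) hv0))

/-- **The re-cut route modulo ONE named fact: `ChruscielDelay_parametricAnnulusGluing → A⁺ →
¬ FinalStateConjecture`** — S1 discharged by `parametricTailGluing_of_annulusGluing`. -/
theorem not_finalStateConjecture_of_nakedLamination_of_gluing
    (hglue : Literature.Geometry.Lorentzian.ChruscielDelay_parametricAnnulusGluing)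
    (hA : ∃ (X : Type) (_ : TopologicalSpace X) (_ : ChartedSpace E3 X) (_ : IsManifold (𝓡 3) ∞ X)
      (_ : T2Space X) (_ : SecondCountableTopology X) (_ : ConnectedSpace X)
      (dstar : InitialDataSet (𝓡 3) X) (Φ : InitialDataSet (𝓡 3) X → ℝ) (K : Set ℝ) (S : Set X)
      (Nk : InitialDataSet (𝓡 3) X → Prop),
      dstar ∈ admissibleVacuumData X ∧
      ¬ ((∃ 𝒟 : VacuumCauchyDevelopment dstar, 𝒟.IsMaximal) ∧
          ∀ 𝒟 : VacuumCauchyDevelopment dstar, 𝒟.IsMaximal → SettlesT2 𝒟) ∧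
      IsCompact S ∧
      (∀ e : AFEnd X, e.IsSoleEnd → ∀ R₀ : ℝ, ∃ R₁ R₂ : ℝ, R₀ ≤ R₁ ∧ e.R ≤ R₁ ∧ R₁ < R₂ ∧
        ¬ ∃ (N : E3 → ℝ) (Y : E3 → E3),
          ContDiffOn ℝ ∞ N {y : E3 | R₁ < ‖y‖ ∧ ‖y‖ < R₂} ∧
          ContDiffOn ℝ ∞ Y {y : E3 | R₁ < ‖y‖ ∧ ‖y‖ < R₂} ∧
          (∃ y : E3, R₁ < ‖y‖ ∧ ‖y‖ < R₂ ∧ (N y ≠ 0 ∨ Y y ≠ 0)) ∧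
          ∀ y : E3, R₁ < ‖y‖ → ‖y‖ < R₂ →
            MetricCoord.adjHamG (e.hCoeff dstar) (e.kCoeff dstar) N y
                + MetricCoord.adjMomGS (e.hCoeff dstar) (e.kCoeff dstar) Y y = 0 ∧
              MetricCoord.adjHamK (e.hCoeff dstar) (e.kCoeff dstar) N y
                + MetricCoord.adjMomKS (e.hCoeff dstar) Y y = 0) ∧
      (∀ d ∈ admissibleVacuumData X, Nk d →
        ¬ ((∃ 𝒟 : VacuumCauchyDevelopment d, 𝒟.IsMaximal) ∧
            ∀ 𝒟 : VacuumCauchyDevelopment d, 𝒟.IsMaximal → SettlesT2 𝒟)) ∧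
      (∀ d₁ ∈ admissibleVacuumData X, ∀ d₂ ∈ admissibleVacuumData X,
        (∀ x ∈ S, d₁.h.inner x = d₂.h.inner x ∧ d₁.k x = d₂.k x) → Nk d₁ → Nk d₂) ∧
      Φ dstar ∈ K ∧
      (∀ ε : ℝ, 0 < ε → (K ∩ Set.Ioo (Φ dstar - ε) (Φ dstar)).Nonempty ∧
        (K ∩ Set.Ioo (Φ dstar) (Φ dstar + ε)).Nonempty) ∧
      ∀ F : EuclideanSpace ℝ (Fin 1) → InitialDataSet (𝓡 3) X, InitialDataSet.IsSmoothDataFamily 1 F →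
        F 0 = dstar → (∀ c, F c ∈ admissibleVacuumData X) →
        (∃ C : Set X, IsCompact C ∧ ∀ c, ∀ x ∉ C, (F c).h.inner x = dstar.h.inner x ∧ (F c).k x = dstar.k x) →
        ∃ δ : ℝ, 0 < δ ∧ ContinuousOn (fun c ↦ Φ (F c)) (Metric.ball 0 δ) ∧
          ∀ c ∈ Metric.ball (0 : EuclideanSpace ℝ (Fin 1)) δ, Φ (F c) ∈ K → Nk (F c)) :
    ¬ FinalStateConjecture :=
  not_finalStateConjecture_of_nakedLamination (parametricTailGluing_of_annulusGluing hglue) hA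

end Summit.FinalStateConjecture.FinalStateConjecture.Theorems.LaminatedThreshold.TailGluing

end
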